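import Summits.QuantumFields.BalabanUV.Beta.GAN24.ContactBorderEntryBoundMf

/-!
# `BalabanUV.Beta.GAN24.ContactBorderEntryBoundTwo` — binder row G-an2-4 / (CONV-C), CT-ROUTE, «(V-C)-DIFF» (the CONTACT V PAIR letter of the born-V rate half), module (A):
# **THE TWO-TOWER ENTRY BOUNDS OF THE V CELLS** (generic `d`) — (B2) `ContactBorderEntryBound.abs_contact_border_fm_le` ∕ (B3) `…Mf.abs_contact_border_mf_le` with the LEFT-slot pair
# `(T_l, B_l, λ_l)` and the TABLE-slot pair `(T_w, B_w, λ_w)` taken from DIFFERENT towers with DIFFERENT letters `(K_l, α_l)`, `(K_w, α_w)`; the diagonal case is (B2) ∕ (B3)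

NOT IN PRINT; OUR BOOKKEEPING (G-an2-4 formalisation swarm → CRUX TEAM (2), leaf prover `b2b-balaban-gan24-formalise-leaf-03`, gen 56; «(V-C)-DIFF» INTENT journal `CLAIMS.log`
[LEAF03-G56-ONLINE]; leaf-04 g57's «BORN-V-DRIFT SOCKET» INTENT names the CONTACT V pairs as the (V-C) author's).  [folklore] bookkeeping over leaf-02 g48's factorised V sockets
`ContactBorderCommutator.contact_border_fm∕mf_eq_factorised` — which ALREADY take independent left and table pairs `lᴱ − lᴮ = dz λ_L`, `wᴱ − wᴮ = dz λ_W` — this seat's (B1)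
`ContactBorderCellLetters.abs_tipCommutator_dz_le_of_staircase_of_le` and (B2) `ContactBorderEntryBound` (the TIP and ROOT cell sums, the sublattice re-indexing), leaf-02 g49's
channel-blind count `ContactLambdaCellBound.abs_sum_tsum_mul_le_of_env3` and localised gauge letters `ContactGaugeStaircaseLocal.*`, leaf-01 g60's `ContactFaceJumpBorder.tipCommutator_eq_sum`,
`ContactLambdaEntryBound.sum_abs_linCountAt_le_cnt` BY NAME.  Generic `d`; every analytic input a LETTER; 0 `def`, 0 cited facts, 0 `def … : Prop`, 0 sorry; NO estimate of Bałaban's.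
HONEST FRAMING (cell contract, verbatim): «discharging `BetaPertH` makes Bałaban's UV stability UNCONDITIONAL — a real constructive-QFT result; it is NOT the continuum limit and NOT the
Clay problem.»  HONEST DEPENDENCY (verbatim): «continuum YM on T⁴ ⇐ BetaPertH ∧ nine spine estimates (0/9 proved); BetaPertH ⇐ (D1) ∧ (D4) ∧ CAP+tail; G-an2-4 gates asym, D1 and NE2/3/4.»

## Why
The top-aligned PAIR of the V contact term (member `k+1` born at `i+1` against member `k` born at `i`) telescopes, one leg at a time (leaf-04's `Push3LegTelescope.push₃_telescope`), into
THREE socket instances whose left pair and table pair come from different towers: (difference tower, taller tower), (shorter, taller) with the DIFFERENCED multiplier leg, (shorter,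
difference tower) — module (B) `ContactBorderPairEntryBound`.  The difference tower's letters carry the Cauchy factor `θ^{i+n}` (CT-4a ∕ CT-4b Pack §A ∕ CT-4d); so the cells must be
bounded with the two pairs' letters kept SEPARATE.  Nothing else changes: (B2)'s script is replayed with duplicated hypotheses.

## What (generic `d`, `1 ≤ Lc`, box root `ρ = toSite rr`; ONE rate `κ`; `E₀ = e^{2(d+1)κ}`, `Cnt = (2Lc)^{d+1}·((d+1)·(Lc^{d+1}·ell))`, `A(α) = 2α + 2α·Lc·n`, `P(a,b) = 4ab + 2(4ab)·Lc·n`)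
* §1 `abs_tipCommutator_dz_le_of_staircase_of_env₂` ((B1)'s TIP × GRADIENT envelope letter with SEPARATE jump letters `F_a`, `F_b`: `≤ (W_a·g_b + (W_a·F_b + F_a·g_b))·(E_a·E_b·Cnt)`),
  **`abs_sum_tsum_tip_dz_le₂`** — the TIP × GRADIENT cell sum with TWO amplitudes (`α_a` for the tip staircase, `α_b` for the gradient staircase): `… ·(E₀²·Cnt)·P(α_a,α_b)·…`.
* §2 **`abs_contact_border_fm_le₂`**: left pair `(T_l, B_l, λ_l)` (letters `C_l, K_l, α_l`), table pair `(T_w, B_w, λ_w)` (letters `C_w, K_w, α_w`), multiplier `M` (summable, tent `T_b`):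
  `|push₃ T_l M T_w S − push₃ B_l M B_w S| (fm entries) ≤ (Lc^{d+1})⁻¹·((d+1)·T_b·(E₀²·Cnt))·(K_w·A(α_l) + P(α_l,α_w) + K_l·A(α_w))·((Lc^n)^{d+1}·Zl(κ∕(4(d+1))))·e^{−(κ∕12)(‖x′−z′‖∞+‖u′−z′‖∞)}`.
NOT HERE: the mf twin (`ContactBorderEntryBoundTwoMf`), the pair telescoping ((B) `ContactBorderPairEntryBound`), the `d = 3` letters and the unit count ((C) ∕ (D)).  Discharges NO letter of (CONV-C); hBdev ∕ (hS, hSall) OPEN; NEVER «G-an2-4 closed» as (CONV-C);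
NOT D1, NOT BetaPertH, NOT continuum, NOT Clay.  Unit `b2b-balaban-gan24-formalise-leaf-03` (gen 56), 2026-08-21.
-/

noncomputable section

open Finset
open scoped BigOperators
open Literature.MathematicalPhysics.QuantumFieldTheory
open Literature.MathematicalPhysics.QuantumFieldTheory.LatticeForm (quo)
open Literature.MathematicalPhysics.QuantumFieldTheory.Balaban1983to89
open Literature.MathematicalPhysics.QuantumFieldTheory.Balaban1983to89.Beta
open B4ContourShift (supNorm supNorm_nonneg)
open ExpKernelCalculus (MKer Zl Zl_nonneg)
open AffineAveraging (Form0 Form1 Site box toSite unitVec dz)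
open AveragingContours (blk off)
open AveragingContoursRooted (linAvgAt)
open AveragingHessianKernels (ell)
open AveragingHessianKernelsRooted (linCountAt vhSAt)
open OneStepResolventKernel (Fib)
open Summit.QuantumFields.BalabanUV.Beta.LinearGaugeVH (nearBox mem_nearBox)
open Summit.QuantumFields.BalabanUV.Beta.GAN24.SrecLinearPartEq (reslot)
open Summit.QuantumFields.BalabanUV.Beta.GAN24.Push3 (push₃)
open Summit.QuantumFields.BalabanUV.Beta.GAN24.Push3LegTelescope (abs_le_of_env' summable_of_env')
open Summit.QuantumFields.BalabanUV.Beta.GAN24.ContactLambdaEntryBound (sum_abs_linCountAt_le_cnt mul_sum_ite)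
open Summit.QuantumFields.BalabanUV.Beta.GAN24.ContactFaceJumpBorder (tipCommutator_eq_sum)
open Summit.QuantumFields.BalabanUV.Beta.GAN24.ContactLambdaCellBound (abs_sum_tsum_mul_le_of_env3)
open Summit.QuantumFields.BalabanUV.Beta.GAN24.ContactGaugeStaircaseLocal (corner_le_of_mem_nearBox_add corner_le_root_add abs_finest_le_env abs_dz_finest_le_env
  sum_abs_jump_le_env)
open Summit.QuantumFields.BalabanUV.Beta.GAN24.ContactBorderCellLetters (abs_tipCommutator_dz_le_of_staircase_of_le)
open Summit.QuantumFields.BalabanUV.Beta.GAN24.ContactBorderCommutator (contact_border_fm_eq_factorised)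
open Summit.QuantumFields.BalabanUV.Beta.GAN24.ContactBorderEntryBound (tsum_sum_mul_ite_off_eq abs_sum_tsum_tip_le abs_sum_tsum_root_le)

namespace Summit.QuantumFields.BalabanUV.Beta.GAN24.ContactBorderEntryBoundTwo

variable {d : ℕ} {Lc : ℕ} {rr : Fin (d + 1) → ℕ}

/-! ## §1 The TIP × GRADIENT cell with two amplitudes -/

section TipDz

variable {n : ℕ} {κ αa αb Tb : ℝ} {Ga Gb : ℕ → Site (d + 1) → ℝ} {ψa ψb : Site (d + 1) → ℝ}
  {b : Fin (d + 1) → Site (d + 1) → ℝ} {xg xl u' : Site (d + 1)}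

/-- NOT IN PRINT; OUR BOOKKEEPING ([folklore] over (B1)'s `abs_tipCommutator_dz_le_of_staircase_of_le`).  **THE TIP × GRADIENT LETTER, ENVELOPE FORM, SEPARATE JUMP LETTERS**:
finest tip weight of `ψ_a` `≤ W_a·E_a`, finest gradient of `ψ_b` `≤ g_b·E_b` on the support box, jumps `J_a ≤ F_a·E_a`, `J_b ≤ F_b·E_b` (`E_a, E_b ≥ 0`), count `≤ Cnt`:
`|[tip commutator of ψ_a](dz ψ_b)(μ,y)| ≤ (W_a·g_b + (W_a·F_b + F_a·g_b))·(E_a·E_b·Cnt)`. -/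
theorem abs_tipCommutator_dz_le_of_staircase_of_env₂ (hLc : 1 ≤ Lc) (hrr : rr ∈ box (d + 1) Lc) (Ga Gb : ℕ → Site (d + 1) → ℝ) (n : ℕ)
    {ψa ψb : Site (d + 1) → ℝ} (hψa : ∀ u, ψa u = ∑ s ∈ Finset.range (n + 1), Ga s (blk (Lc ^ s) u))
    (hψb : ∀ u, ψb u = ∑ s ∈ Finset.range (n + 1), Gb s (blk (Lc ^ s) u)) (μ : Fin (d + 1)) (y : Site (d + 1))
    {Wa gb Fa Fb Ea Eb Cnt : ℝ} (hWa0 : 0 ≤ Wa) (hgb0 : 0 ≤ gb) (hEa : 0 ≤ Ea) (hEb : 0 ≤ Eb)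
    (hWa : ∀ α, ∀ x ∈ nearBox Lc y, |Ga 0 (x + unitVec α) - Ga 0 ((Lc : ℤ) • y + toSite rr + (Lc : ℤ) • unitVec μ)| ≤ Wa * Ea)
    (hgb : ∀ α, ∀ x ∈ nearBox Lc y, |dz (Gb 0) α x| ≤ gb * Eb)
    (hJa : ∑ s ∈ Finset.range n, |Ga (s + 1) (blk (Lc ^ s) (y + unitVec μ)) - Ga (s + 1) (blk (Lc ^ s) y)| ≤ Fa * Ea)
    (hJb : ∑ s ∈ Finset.range n, |Gb (s + 1) (blk (Lc ^ s) (y + unitVec μ)) - Gb (s + 1) (blk (Lc ^ s) y)| ≤ Fb * Eb)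
    (hCnt : ∑ x ∈ nearBox Lc y, ∑ α, |(linCountAt (toSite rr) Lc μ y (α, x) : ℝ)| ≤ Cnt) :
    |linAvgAt (toSite rr) (fun α x => ψa (x + unitVec α) * dz ψb α x) Lc μ y
        - ψa ((Lc : ℤ) • y + toSite rr + (Lc : ℤ) • unitVec μ) * linAvgAt (toSite rr) (dz ψb) Lc μ y|
      ≤ (Wa * gb + (Wa * Fb + Fa * gb)) * (Ea * Eb * Cnt) := by
  have h := abs_tipCommutator_dz_le_of_staircase_of_le hLc hrr Ga Gb n n hψa hψb μ y (mul_nonneg hWa0 hEa) hWa hgb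
  set Ja : ℝ := ∑ s ∈ Finset.range n, |Ga (s + 1) (blk (Lc ^ s) (y + unitVec μ)) - Ga (s + 1) (blk (Lc ^ s) y)| with hJadef
  set Jb : ℝ := ∑ s ∈ Finset.range n, |Gb (s + 1) (blk (Lc ^ s) (y + unitVec μ)) - Gb (s + 1) (blk (Lc ^ s) y)| with hJbdef
  have hJa0 : 0 ≤ Ja := Finset.sum_nonneg fun _ _ => abs_nonneg _
  have hJb0 : 0 ≤ Jb := Finset.sum_nonneg fun _ _ => abs_nonneg _
  have hc0 : 0 ≤ ∑ x ∈ nearBox Lc y, ∑ α, |(linCountAt (toSite rr) Lc μ y (α, x) : ℝ)| :=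
    Finset.sum_nonneg fun _ _ => Finset.sum_nonneg fun _ _ => abs_nonneg _
  refine h.trans ?_
  have hpre : Wa * Ea * (gb * Eb + Jb) + Ja * (gb * Eb) ≤ (Wa * gb + (Wa * Fb + Fa * gb)) * (Ea * Eb) := by
    have h1 : Wa * Ea * Jb ≤ Wa * Ea * (Fb * Eb) := mul_le_mul_of_nonneg_left hJb (mul_nonneg hWa0 hEa)
    have h2 : Ja * (gb * Eb) ≤ (Fa * Ea) * (gb * Eb) := mul_le_mul_of_nonneg_right hJa (mul_nonneg hgb0 hEb)
    nlinarith
  have hpre0 : 0 ≤ Wa * Ea * (gb * Eb + Jb) + Ja * (gb * Eb) := by positivity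
  calc (Wa * Ea * (gb * Eb + Jb) + Ja * (gb * Eb)) * ∑ x ∈ nearBox Lc y, ∑ α, |(linCountAt (toSite rr) Lc μ y (α, x) : ℝ)|
      ≤ ((Wa * gb + (Wa * Fb + Fa * gb)) * (Ea * Eb)) * Cnt := mul_le_mul hpre hCnt hc0 (hpre0.trans hpre)
    _ = (Wa * gb + (Wa * Fb + Fa * gb)) * (Ea * Eb * Cnt) := by ring

/-- NOT IN PRINT; OUR BOOKKEEPING ([folklore]; every input a letter).  **THE TIP × GRADIENT CELL WITH TWO AMPLITUDES**: tip staircase `ψ_a` with localised geometric pieces of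
letter `α_a` (source `x_g`), gradient staircase `ψ_b` of letter `α_b` (source `x_l`), brackets under the tent letter:
`|Σ_μ Σ'_y b μ y·[tip commutator of ψ_a](dz ψ_b)(μ,y)| ≤ (d+1)·T_b·(E₀²·Cnt)·(4α_aα_b + 2·(4α_aα_b)·Lc·n)·((Lc^n)^{d+1}·Zl)·e^{−(κ∕12)(‖x_g − u′‖∞ + ‖x_l − u′‖∞)}` and every `y`-family
is summable — (B2)'s `abs_sum_tsum_tip_dz_le` is the diagonal `α_a = α_b`; the cross jump terms `W_a·F_b + F_a·g_b` recombine to ONE `ite`-sum of letter `4α_aα_b`. -/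
theorem abs_sum_tsum_tip_dz_le₂ (hLc : 1 ≤ Lc) (hrr : rr ∈ box (d + 1) Lc) (hκ : 0 < κ) (hαa : 0 ≤ αa) (hαb : 0 ≤ αb) (hTb : 0 ≤ Tb)
    (hψa : ∀ u, ψa u = ∑ s ∈ Finset.range (n + 1), Ga s (blk (Lc ^ s) u))
    (hψb : ∀ u, ψb u = ∑ s ∈ Finset.range (n + 1), Gb s (blk (Lc ^ s) u))
    (hGa : ∀ s, s ≤ n → ∀ u, |Ga s (blk (Lc ^ s) u)| ≤ αa * (Lc : ℝ) ^ s * Real.exp (-(κ * supNorm (quo (Lc ^ (n + 1)) u - xg))))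
    (hGb : ∀ s, s ≤ n → ∀ u, |Gb s (blk (Lc ^ s) u)| ≤ αb * (Lc : ℝ) ^ s * Real.exp (-(κ * supNorm (quo (Lc ^ (n + 1)) u - xl))))
    (hb : ∀ μ y, |b μ y| ≤ Tb * Real.exp (-(κ * supNorm (quo (Lc ^ n) y - u')))) :
    (∀ μ, Summable fun y : Site (d + 1) => b μ y *
        (linAvgAt (toSite rr) (fun a x => ψa (x + unitVec a) * dz ψb a x) Lc μ y
          - ψa ((Lc : ℤ) • y + toSite rr + (Lc : ℤ) • unitVec μ) * linAvgAt (toSite rr) (dz ψb) Lc μ y)) ∧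
    |∑ μ, ∑' y : Site (d + 1), b μ y *
        (linAvgAt (toSite rr) (fun a x => ψa (x + unitVec a) * dz ψb a x) Lc μ y
          - ψa ((Lc : ℤ) • y + toSite rr + (Lc : ℤ) • unitVec μ) * linAvgAt (toSite rr) (dz ψb) Lc μ y)|
      ≤ ((d : ℝ) + 1) * Tb * (Real.exp (2 * ((d : ℝ) + 1) * κ) ^ 2 *
            (((2 * Lc : ℕ) : ℝ) ^ (d + 1) * (((d + 1 : ℕ) : ℝ) * ((Lc : ℝ) ^ (d + 1) * (ell (d + 1) Lc : ℝ)))))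
          * (4 * (αa * αb) + 2 * (4 * (αa * αb)) * Lc * n) * ((((Lc ^ n : ℕ) : ℝ)) ^ (d + 1) * Zl (d + 1) (κ / (4 * ((d : ℝ) + 1)))) *
          Real.exp (-(κ / 12) * (supNorm (xg - u') + supNorm (xl - u'))) := by
  set E₀ : ℝ := Real.exp (2 * ((d : ℝ) + 1) * κ) with hE₀
  set Cnt : ℝ := ((2 * Lc : ℕ) : ℝ) ^ (d + 1) * (((d + 1 : ℕ) : ℝ) * ((Lc : ℝ) ^ (d + 1) * (ell (d + 1) Lc : ℝ))) with hCnt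
  have hE₀0 : 0 ≤ E₀ := (Real.exp_pos _).le
  have hLn : 1 ≤ Lc ^ n := Nat.one_le_pow _ _ hLc
  have hc : ∀ μ y, |linAvgAt (toSite rr) (fun a x => ψa (x + unitVec a) * dz ψb a x) Lc μ y
        - ψa ((Lc : ℤ) • y + toSite rr + (Lc : ℤ) • unitVec μ) * linAvgAt (toSite rr) (dz ψb) Lc μ y|
      ≤ (4 * (αa * αb) + ∑ s ∈ Finset.range n, (if (Lc : ℤ) ^ s ∣ y μ + 1 then 2 * ((fun m => 4 * αa * (αb * (Lc : ℝ) ^ m)) (s + 1)) else 0)) *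
        ((E₀ ^ 2 * Cnt) * Real.exp (-(κ * supNorm (quo (Lc ^ n) y - xg))) * Real.exp (-(κ * supNorm (quo (Lc ^ n) y - xl)))) := by
    intro μ y
    classical
    have hWa : ∀ a, ∀ x ∈ nearBox Lc y, |Ga 0 (x + unitVec a) - Ga 0 ((Lc : ℤ) • y + toSite rr + (Lc : ℤ) • unitVec μ)|
        ≤ 2 * αa * (E₀ * Real.exp (-(κ * supNorm (quo (Lc ^ n) y - xg)))) := by
      intro a x hx
      have h1 := abs_finest_le_env hLc hκ.le hαa hGa (corner_le_of_mem_nearBox_add hLc hx a)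
      have h2 := abs_finest_le_env hLc hκ.le hαa hGa (corner_le_root_add hrr y μ)
      calc |Ga 0 (x + unitVec a) - Ga 0 ((Lc : ℤ) • y + toSite rr + (Lc : ℤ) • unitVec μ)|
          ≤ |Ga 0 (x + unitVec a)| + |Ga 0 ((Lc : ℤ) • y + toSite rr + (Lc : ℤ) • unitVec μ)| := abs_sub _ _
        _ ≤ _ := by linarith
    have hgb := fun a x (hx : x ∈ nearBox Lc y) => abs_dz_finest_le_env hLc hκ.le hαb hGb y a hx
    have hJa := sum_abs_jump_le_env hLc hκ.le hαa hGa μ y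
    have hJb := sum_abs_jump_le_env hLc hκ.le hαb hGb μ y
    have h := abs_tipCommutator_dz_le_of_staircase_of_env₂ hLc hrr Ga Gb n hψa hψb μ y (Wa := 2 * αa) (gb := 2 * αb)
      (Fa := ∑ s ∈ Finset.range n, (if (Lc : ℤ) ^ s ∣ y μ + 1 then 2 * (αa * (Lc : ℝ) ^ (s + 1)) else 0))
      (Fb := ∑ s ∈ Finset.range n, (if (Lc : ℤ) ^ s ∣ y μ + 1 then 2 * (αb * (Lc : ℝ) ^ (s + 1)) else 0))
      (Ea := E₀ * Real.exp (-(κ * supNorm (quo (Lc ^ n) y - xg)))) (Eb := E₀ * Real.exp (-(κ * supNorm (quo (Lc ^ n) y - xl))))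
      (by positivity) (by positivity) (by positivity) (by positivity) hWa hgb hJa hJb
      (sum_abs_linCountAt_le_cnt hLc hrr μ y)
    refine h.trans (le_of_eq ?_)
    rw [show (2 * αa) * ∑ s ∈ Finset.range n, (if (Lc : ℤ) ^ s ∣ y μ + 1 then 2 * (αb * (Lc : ℝ) ^ (s + 1)) else 0)
        + (∑ s ∈ Finset.range n, (if (Lc : ℤ) ^ s ∣ y μ + 1 then 2 * (αa * (Lc : ℝ) ^ (s + 1)) else 0)) * (2 * αb)
      = ∑ s ∈ Finset.range n, (if (Lc : ℤ) ^ s ∣ y μ + 1 then 2 * ((fun m => 4 * αa * (αb * (Lc : ℝ) ^ m)) (s + 1)) else 0) by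
        rw [mul_comm _ (2 * αb), mul_sum_ite, mul_sum_ite, ← Finset.sum_add_distrib]
        refine Finset.sum_congr rfl fun s _ => ?_
        split_ifs <;> ring]
    ring
  have ha : ∀ s, s < n → 0 ≤ (fun m => 4 * αa * (αb * (Lc : ℝ) ^ m)) (s + 1) ∧
      (fun m => 4 * αa * (αb * (Lc : ℝ) ^ m)) (s + 1) ≤ (4 * (αa * αb)) * (Lc : ℝ) ^ (s + 1) :=
    fun s _ => ⟨by positivity, le_of_eq (by simp only []; ring)⟩
  exact abs_sum_tsum_mul_le_of_env3 (d := d) (Lc := Lc) (M := Lc ^ n) (n := n) hLc hLn (fun s hs => pow_dvd_pow Lc hs.le) hκ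
    (a := fun m => 4 * αa * (αb * (Lc : ℝ) ^ m)) ha (b := b)
    (c := fun μ y => linAvgAt (toSite rr) (fun a x => ψa (x + unitVec a) * dz ψb a x) Lc μ y
          - ψa ((Lc : ℤ) • y + toSite rr + (Lc : ℤ) • unitVec μ) * linAvgAt (toSite rr) (dz ψb) Lc μ y)
    hTb (by positivity : 0 ≤ E₀ ^ 2 * Cnt) (by positivity : (0 : ℝ) ≤ 4 * (αa * αb)) u' xg xl hb hc

end TipDz

/-! ## §2 The two-tower entry bound of the fm channel -/

section Fm

variable [NeZero Lc] {n : ℕ} {κ αl αw KBl KBw CTl CTw Tb : ℝ}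
  {Tl Bl Tw Bw M : Fin (d + 1) → (Fin (d + 1) → ℤ) → Fin (d + 1) → (Fin (d + 1) → ℤ) → ℝ}
  {laml lamw : Fin (d + 1) → (Fin (d + 1) → ℤ) → (Fin (d + 1) → ℤ) → ℝ}
  {Gl Gw : Fin (d + 1) → (Fin (d + 1) → ℤ) → ℕ → Site (d + 1) → ℝ}

/-- NOT IN PRINT; OUR BOOKKEEPING ([folklore]; every analytic input a LETTER).  **THE TWO-TOWER ENTRY BOUND OF THE fm-CHANNEL V CELLS.**  LEFT pair `(T_l, B_l)` (`T_l` bounded with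
summable fine slices, `B_l` under the block envelope `K_l·e^{−κ‖quo (Lc^{n+1}) u − z‖∞}`, `T_l − B_l = dz λ_l`, `λ_l` staircases of depth `n+1` with localised geometric pieces `α_l·Lc^s`),
TABLE pair `(T_w, B_w)` likewise with letters `K_w, α_w`, a multiplier leg `M` with summable fine slices under the TENT letter `|M β z′ μ (Lc•y)| ≤ T_b·e^{−κ‖quo (Lc^n) y − z′‖∞}`.  THEN for
all `κ′ u′ x′ z′ α β`, with `V_ρ = vhSAt ρ d Lc`,
`|push₃ T_l M T_w (reslot inl inr V_ρ) κ′u′ x′z′ (inl α)(inl β) − push₃ B_l M B_w (reslot inl inr V_ρ) κ′u′ x′z′ (inl α)(inl β)|`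
`≤ (Lc^{d+1})⁻¹·((d+1)·T_b·(E₀²·Cnt))·(K_w·A(α_l) + P(α_l,α_w) + K_l·A(α_w))·((Lc^n)^{d+1}·Zl(κ∕(4(d+1))))·e^{−(κ∕12)(‖x′−z′‖∞ + ‖u′−z′‖∞)}`,
`A(α) = 2α + 2α·Lc·n`, `P(a,b) = 4ab + 2(4ab)·Lc·n` — TIP cell (gauge `λ_l`, leg `B_w`), TIP × GRADIENT cell (`λ_l`, `dz λ_w`, two amplitudes), ROOT cell (gauge `λ_w`, leg `B_l`). -/
theorem abs_contact_border_fm_le₂ (hLc : 1 ≤ Lc) (hrr : rr ∈ box (d + 1) Lc) (hκ : 0 < κ) (hαl : 0 ≤ αl) (hαw : 0 ≤ αw) (hKBl : 0 ≤ KBl)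
    (hKBw : 0 ≤ KBw) (hTb : 0 ≤ Tb)
    (hTl : ∀ μ z κ u, |Tl μ z κ u| ≤ CTl) (hTls : ∀ μ z κ, Summable fun u => Tl μ z κ u)
    (hBl : ∀ μ z l u, |Bl μ z l u| ≤ KBl * Real.exp (-(κ * supNorm (quo (Lc ^ (n + 1)) u - z))))
    (hTBl : Tl - Bl = fun μ z κ u => dz (laml μ z) κ u)
    (hψl : ∀ μ₀ z₀ u, laml μ₀ z₀ u = ∑ s ∈ Finset.range (n + 1), Gl μ₀ z₀ s (blk (Lc ^ s) u))
    (hGl : ∀ μ₀ z₀ s, s ≤ n → ∀ u, |Gl μ₀ z₀ s (blk (Lc ^ s) u)| ≤ αl * (Lc : ℝ) ^ s * Real.exp (-(κ * supNorm (quo (Lc ^ (n + 1)) u - z₀))))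
    (hTw : ∀ μ z κ u, |Tw μ z κ u| ≤ CTw)
    (hBw : ∀ μ z l u, |Bw μ z l u| ≤ KBw * Real.exp (-(κ * supNorm (quo (Lc ^ (n + 1)) u - z))))
    (hTBw : Tw - Bw = fun μ z κ u => dz (lamw μ z) κ u)
    (hψw : ∀ μ₀ z₀ u, lamw μ₀ z₀ u = ∑ s ∈ Finset.range (n + 1), Gw μ₀ z₀ s (blk (Lc ^ s) u))
    (hGw : ∀ μ₀ z₀ s, s ≤ n → ∀ u, |Gw μ₀ z₀ s (blk (Lc ^ s) u)| ≤ αw * (Lc : ℝ) ^ s * Real.exp (-(κ * supNorm (quo (Lc ^ (n + 1)) u - z₀))))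
    (hMs : ∀ β z' μ, Summable fun z => M β z' μ z)
    (hMt : ∀ (β : Fin (d + 1)) (z' : Site (d + 1)) (μ : Fin (d + 1)) (y : Site (d + 1)),
      |M β z' μ ((Lc : ℤ) • y)| ≤ Tb * Real.exp (-(κ * supNorm (quo (Lc ^ n) y - z'))))
    (κ' : Fin (d + 1)) (u' x' z' : Site (d + 1)) (α β : Fin (d + 1)) :
    |push₃ Tl M Tw (reslot Sum.inl Sum.inr (vhSAt (toSite rr) d Lc rfl)) κ' u' x' z' (Sum.inl α) (Sum.inl β)
        - push₃ Bl M Bw (reslot Sum.inl Sum.inr (vhSAt (toSite rr) d Lc rfl)) κ' u' x' z' (Sum.inl α) (Sum.inl β)|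
      ≤ ((Lc : ℝ) ^ (d + 1))⁻¹ *
          ((((d : ℝ) + 1) * Tb * (Real.exp (2 * ((d : ℝ) + 1) * κ) ^ 2 *
              (((2 * Lc : ℕ) : ℝ) ^ (d + 1) * (((d + 1 : ℕ) : ℝ) * ((Lc : ℝ) ^ (d + 1) * (ell (d + 1) Lc : ℝ))))))
            * (KBw * (2 * αl + 2 * αl * Lc * n) + (4 * (αl * αw) + 2 * (4 * (αl * αw)) * Lc * n) + KBl * (2 * αw + 2 * αw * Lc * n))
            * ((((Lc ^ n : ℕ) : ℝ)) ^ (d + 1) * Zl (d + 1) (κ / (4 * ((d : ℝ) + 1))))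
            * Real.exp (-(κ / 12) * (supNorm (x' - z') + supNorm (u' - z')))) := by
  -- the leg classes of `B_l`, `B_w` and the socket
  have hLn1 : 1 ≤ Lc ^ (n + 1) := Nat.one_le_pow _ _ hLc
  have hBlb : ∀ μ z l u, |Bl μ z l u| ≤ KBl := abs_le_of_env' hκ.le hBl
  have hBls : ∀ μ z l, Summable fun u => Bl μ z l u := summable_of_env' hLn1 hκ hBl
  have hBwb : ∀ μ z l u, |Bw μ z l u| ≤ KBw := abs_le_of_env' hκ.le hBw
  rw [contact_border_fm_eq_factorised hLc hrr hTl hTls hBlb hBls hMs hTw hBwb hTBl hTBw κ' u' x' z' α β]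
  -- sublattice re-indexing of the two cells
  rw [tsum_sum_mul_ite_off_eq hLc (fun μ z => M β z' μ z) (fun μ y z => ((Lc : ℝ) ^ (d + 1))⁻¹ *
      (linAvgAt (toSite rr) (fun κ u => laml α x' (u + unitVec κ) * Tw κ' u' κ u) Lc μ y
        - laml α x' (z + toSite rr + (Lc : ℤ) • unitVec μ) * linAvgAt (toSite rr) (Tw κ' u') Lc μ y)),
    tsum_sum_mul_ite_off_eq hLc (fun μ z => M β z' μ z) (fun μ y z => ((Lc : ℝ) ^ (d + 1))⁻¹ *
      (lamw κ' u' (z + toSite rr) * linAvgAt (toSite rr) (Bl α x') Lc μ y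
        - linAvgAt (toSite rr) (fun a x => lamw κ' u' x * Bl α x' a x) Lc μ y))]
  -- the split of the TIP cell's dressed table leg `T_w κ′ u′ = B_w κ′ u′ + dz (λ_w κ′ u′)`
  have eT : ∀ b z, Tw κ' u' b z = Bw κ' u' b z + dz (lamw κ' u') b z := fun b z => by
    have h := congrFun (congrFun (congrFun (congrFun hTBw κ') u') b) z
    simp only [Pi.sub_apply] at h
    linarith
  have hsplit : ∀ μ y,
      linAvgAt (toSite rr) (fun b z => laml α x' (z + unitVec b) * Tw κ' u' b z) Lc μ y
          - laml α x' ((Lc : ℤ) • y + toSite rr + (Lc : ℤ) • unitVec μ) * linAvgAt (toSite rr) (Tw κ' u') Lc μ y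
        = (linAvgAt (toSite rr) (fun b z => laml α x' (z + unitVec b) * Bw κ' u' b z) Lc μ y
            - laml α x' ((Lc : ℤ) • y + toSite rr + (Lc : ℤ) • unitVec μ) * linAvgAt (toSite rr) (Bw κ' u') Lc μ y)
          + (linAvgAt (toSite rr) (fun b z => laml α x' (z + unitVec b) * dz (lamw κ' u') b z) Lc μ y
            - laml α x' ((Lc : ℤ) • y + toSite rr + (Lc : ℤ) • unitVec μ) * linAvgAt (toSite rr) (dz (lamw κ' u')) Lc μ y) := by
    intro μ y
    rw [tipCommutator_eq_sum hrr, tipCommutator_eq_sum hrr, tipCommutator_eq_sum hrr (laml α x') (dz (lamw κ' u')), ← Finset.sum_add_distrib]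
    refine Finset.sum_congr rfl fun x _ => ?_
    rw [← Finset.sum_add_distrib]
    refine Finset.sum_congr rfl fun a _ => ?_
    rw [eT a x]; ring
  -- the three cells (brackets `b μ y := M β z′ μ (Lc•y)`, tent label `z′`)
  obtain ⟨hs1, hb1⟩ := abs_sum_tsum_tip_le (b := fun μ y => M β z' μ ((Lc : ℤ) • y)) (xg := x') (xl := u') (u' := z')
    hLc hrr hκ hαl hKBw hTb (hψl α x') (hGl α x') (fun a x => hBw κ' u' a x) (hMt β z')
  obtain ⟨hs2, hb2⟩ := abs_sum_tsum_tip_dz_le₂ (b := fun μ y => M β z' μ ((Lc : ℤ) • y)) (xg := x') (xl := u') (u' := z')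
    hLc hrr hκ hαl hαw hTb (hψl α x') (hψw κ' u') (hGl α x') (hGw κ' u') (hMt β z')
  obtain ⟨hs3, hb3⟩ := abs_sum_tsum_root_le (b := fun μ y => M β z' μ ((Lc : ℤ) • y)) (xg := u') (xl := x') (u' := z')
    hLc hrr hκ hαw hKBl hTb (hψw κ' u') (hGw κ' u') (fun a x => hBl α x' a x) (hMt β z')
  rw [add_comm (supNorm (u' - z')) (supNorm (x' - z'))] at hb3
  -- regroup the first cell: constant out, split, exchange
  set c₀ : ℝ := ((Lc : ℝ) ^ (d + 1))⁻¹ with hc₀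
  have e1 : (∑' y : Site (d + 1), ∑ μ, M β z' μ ((Lc : ℤ) • y) * (c₀ *
        (linAvgAt (toSite rr) (fun κ u => laml α x' (u + unitVec κ) * Tw κ' u' κ u) Lc μ y
          - laml α x' ((Lc : ℤ) • y + toSite rr + (Lc : ℤ) • unitVec μ) * linAvgAt (toSite rr) (Tw κ' u') Lc μ y)))
      = c₀ * ((∑ μ, ∑' y : Site (d + 1), M β z' μ ((Lc : ℤ) • y) *
          (linAvgAt (toSite rr) (fun b z => laml α x' (z + unitVec b) * Bw κ' u' b z) Lc μ y
            - laml α x' ((Lc : ℤ) • y + toSite rr + (Lc : ℤ) • unitVec μ) * linAvgAt (toSite rr) (Bw κ' u') Lc μ y))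
        + ∑ μ, ∑' y : Site (d + 1), M β z' μ ((Lc : ℤ) • y) *
          (linAvgAt (toSite rr) (fun b z => laml α x' (z + unitVec b) * dz (lamw κ' u') b z) Lc μ y
            - laml α x' ((Lc : ℤ) • y + toSite rr + (Lc : ℤ) • unitVec μ) * linAvgAt (toSite rr) (dz (lamw κ' u')) Lc μ y)) := by
    have step1 : ∀ y : Site (d + 1), (∑ μ, M β z' μ ((Lc : ℤ) • y) * (c₀ *
        (linAvgAt (toSite rr) (fun κ u => laml α x' (u + unitVec κ) * Tw κ' u' κ u) Lc μ y
          - laml α x' ((Lc : ℤ) • y + toSite rr + (Lc : ℤ) • unitVec μ) * linAvgAt (toSite rr) (Tw κ' u') Lc μ y)))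
        = c₀ * ∑ μ, (M β z' μ ((Lc : ℤ) • y) *
            (linAvgAt (toSite rr) (fun b z => laml α x' (z + unitVec b) * Bw κ' u' b z) Lc μ y
              - laml α x' ((Lc : ℤ) • y + toSite rr + (Lc : ℤ) • unitVec μ) * linAvgAt (toSite rr) (Bw κ' u') Lc μ y)
          + M β z' μ ((Lc : ℤ) • y) *
            (linAvgAt (toSite rr) (fun b z => laml α x' (z + unitVec b) * dz (lamw κ' u') b z) Lc μ y
              - laml α x' ((Lc : ℤ) • y + toSite rr + (Lc : ℤ) • unitVec μ) * linAvgAt (toSite rr) (dz (lamw κ' u')) Lc μ y)) := by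
      intro y
      rw [Finset.mul_sum]
      refine Finset.sum_congr rfl fun μ _ => ?_
      rw [hsplit μ y]; ring
    rw [tsum_congr step1, tsum_mul_left, Summable.tsum_finsetSum (fun μ _ => (hs1 μ).add (hs2 μ))]
    congr 1
    rw [← Finset.sum_add_distrib]
    exact Finset.sum_congr rfl fun μ _ => (hs1 μ).tsum_add (hs2 μ)
  have e2 : (∑' y : Site (d + 1), ∑ μ, M β z' μ ((Lc : ℤ) • y) * (c₀ *
        (lamw κ' u' ((Lc : ℤ) • y + toSite rr) * linAvgAt (toSite rr) (Bl α x') Lc μ y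
          - linAvgAt (toSite rr) (fun a x => lamw κ' u' x * Bl α x' a x) Lc μ y)))
      = c₀ * ∑ μ, ∑' y : Site (d + 1), M β z' μ ((Lc : ℤ) • y) *
          (lamw κ' u' ((Lc : ℤ) • y + toSite rr) * linAvgAt (toSite rr) (Bl α x') Lc μ y
            - linAvgAt (toSite rr) (fun a x => lamw κ' u' x * Bl α x' a x) Lc μ y) := by
    rw [← Summable.tsum_finsetSum (fun μ _ => hs3 μ), ← tsum_mul_left]
    refine tsum_congr fun y => ?_
    rw [Finset.mul_sum]
    exact Finset.sum_congr rfl fun μ _ => by ring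
  rw [e1, e2, ← mul_add]
  have hc0 : 0 ≤ c₀ := by positivity
  rw [abs_mul, abs_of_nonneg hc0]
  refine (mul_le_mul_of_nonneg_left ((abs_add_le _ _).trans (add_le_add ((abs_add_le _ _).trans (add_le_add hb1 hb2)) hb3)) hc0).trans
    (le_of_eq ?_)
  ring

end Fm

end Summit.QuantumFields.BalabanUV.Beta.GAN24.ContactBorderEntryBoundTwo

end
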